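import Literature.Geometry.Lorentzian.SpacetimeLocalConvergence
import HarnessLib

/-!
# The tilt of a pointed `Cᵏ_loc` convergence datum at the base point (a frame-bound clause)
(topic `Geometry/Lorentzian`; framed / bounded-boost pointed convergence of Lorentzian manifolds —
Anderson 2004, §5 (control of the lapse/tilt in Cheeger–Gromov convergence of spacetimes); the
necessity of such a clause is Geroch 1969, §3, see `PlaneWaveMinkowskiLimit.lean`)

For a datum `D : (𝓢ₙ, pₙ) ⇀ (𝓣, t)` with comparison maps `φₙ`, the **tilt** of `φₙ` at the base
point is the normalised scalar product
`tilt D n = −gₙ(dφₙ T(t), Tₙ(pₙ)) / (|T(t)|_g · |Tₙ(pₙ)|_{gₙ})`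
of the image of the orienting field of the limit with the orienting field of the `n`-th spacetime
at its base point — the hyperbolic cosine of the boost angle between the two observers, up to the
`o(1)` by which `dφₙ` fails to be isometric at `t`. A datum is **tilt-bounded**
(`IsTiltBounded`) if these numbers are bounded. The constant datum `refl` has tilt `1`
(`tilt_refl`); the degenerate plane-wave-to-Minkowski datum of `PlaneWaveMinkowskiLimit.lean` has
tilt `(cₙ + cₙ⁻¹)/2 → ∞` (`PlaneWaveTilt.lean`): tilt-boundedness is exactly the clause that
excludes the boost degeneration responsible for the non-uniqueness of Lorentzian pointed limits.

## References
* [Anderson2004] M. T. Anderson, *Cheeger–Gromov theory and applications to general relativity*,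
  in: The Einstein Equations and the Large Scale Behavior of Gravitational Fields, Birkhäuser 2004, §5.
* [Geroch1969] R. Geroch, *Limits of spacetimes*, Comm. Math. Phys. 13 (1969) 180–193, §3.
-/

noncomputable section

open TopologicalSpace Manifold Filter Topology Set Function

universe u v

namespace Literature.Geometry.Lorentzian

namespace Spacetime

namespace LocalSubconvergence

variable {𝓢ₙ : ℕ → Spacetime.{u} 4} {pₙ : ∀ n, (𝓢ₙ n).carrier} {𝓣 : Spacetime.{v} 4}
  {t : 𝓣.carrier} {k : ℕ}

/-- The **tilt** of the `n`-th comparison map at the base point: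
`−gₙ(dφₙ T(t), Tₙ(pₙ)) / (√(−g(T,T)) · √(−gₙ(Tₙ,Tₙ)))`, the normalised scalar product of the image
of the limit's orienting vector with the orienting vector of `𝓢ₙ` at `pₙ` (`= cosh` of the boost
angle for an isometric `dφₙ`). [cite: Anderson2004, §5] -/
def tilt (D : LocalSubconvergence 𝓢ₙ pₙ 𝓣 t k) (n : ℕ) : ℝ :=
  -(𝓢ₙ (D.sub n)).metric.val (D.embed n t)
      (mfderiv (𝓡 4) (𝓡 4) (D.embed n) t (𝓣.timeOrientation.vectorField t))
      ((𝓢ₙ (D.sub n)).timeOrientation.vectorField (D.embed n t)) /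
    (Real.sqrt (-𝓣.metric.val t (𝓣.timeOrientation.vectorField t)
        (𝓣.timeOrientation.vectorField t)) *
      Real.sqrt (-(𝓢ₙ (D.sub n)).metric.val (D.embed n t)
        ((𝓢ₙ (D.sub n)).timeOrientation.vectorField (D.embed n t))
        ((𝓢ₙ (D.sub n)).timeOrientation.vectorField (D.embed n t))))

/-- The normalising denominator of the tilt is positive (both orienting vectors are timelike). [folklore] -/
theorem tilt_denom_pos (D : LocalSubconvergence 𝓢ₙ pₙ 𝓣 t k) (n : ℕ) :
    0 < Real.sqrt (-𝓣.metric.val t (𝓣.timeOrientation.vectorField t)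
        (𝓣.timeOrientation.vectorField t)) *
      Real.sqrt (-(𝓢ₙ (D.sub n)).metric.val (D.embed n t)
        ((𝓢ₙ (D.sub n)).timeOrientation.vectorField (D.embed n t))
        ((𝓢ₙ (D.sub n)).timeOrientation.vectorField (D.embed n t))) :=
  mul_pos (Real.sqrt_pos.2 (neg_pos.2 (𝓣.timeOrientation.isTimelike t)))
    (Real.sqrt_pos.2 (neg_pos.2 ((𝓢ₙ (D.sub n)).timeOrientation.isTimelike _)))

/-- The tilt is positive: `dφₙ T(t)` is future-directed, so `gₙ(Tₙ, dφₙ T) < 0`. [cite: Anderson2004, §5] -/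
theorem tilt_pos (D : LocalSubconvergence 𝓢ₙ pₙ 𝓣 t k) (n : ℕ) : 0 < D.tilt n := by
  unfold tilt
  refine div_pos (neg_pos.2 ?_) (D.tilt_denom_pos n)
  rw [(𝓢ₙ (D.sub n)).metric.symm]
  exact (D.isFutureDirected_mfderiv_embed n t (D.basepoint_mem_U n)).2

/-- A datum is **tilt-bounded** if the tilts of its comparison maps at the base point are bounded:
the clause excluding the boost degeneration of Lorentzian pointed limits (Geroch 1969, §3). [cite: Anderson2004, §5] -/
def IsTiltBounded (D : LocalSubconvergence 𝓢ₙ pₙ 𝓣 t k) : Prop := ∃ C : ℝ, ∀ n, D.tilt n ≤ C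

/-- **The constant datum has tilt `1`.** [folklore] -/
theorem tilt_refl (𝓢 : Spacetime.{u} 4) (p : 𝓢.carrier) (k n : ℕ) : (refl 𝓢 p k).tilt n = 1 := by
  unfold tilt
  have hT : 𝓢.metric.val p (𝓢.timeOrientation.vectorField p) (𝓢.timeOrientation.vectorField p) <
      0 := 𝓢.timeOrientation.isTimelike p
  have hid : mfderiv (𝓡 4) (𝓡 4) (id : 𝓢.carrier → 𝓢.carrier) p
      (𝓢.timeOrientation.vectorField p) = 𝓢.timeOrientation.vectorField p := by
    rw [mfderiv_id]
    rfl
  show -(𝓢.metric.val p (mfderiv (𝓡 4) (𝓡 4) id p (𝓢.timeOrientation.vectorField p))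
      (𝓢.timeOrientation.vectorField p)) /
      (Real.sqrt (-𝓢.metric.val p (𝓢.timeOrientation.vectorField p)
        (𝓢.timeOrientation.vectorField p)) *
        Real.sqrt (-𝓢.metric.val p (𝓢.timeOrientation.vectorField p)
          (𝓢.timeOrientation.vectorField p))) = 1
  rw [hid, ← Real.sqrt_mul (neg_nonneg.2 hT.le), Real.sqrt_mul_self (neg_nonneg.2 hT.le),
    div_self (neg_ne_zero.2 hT.ne)]

/-- The constant datum is tilt-bounded. [folklore] -/
theorem isTiltBounded_refl (𝓢 : Spacetime.{u} 4) (p : 𝓢.carrier) (k : ℕ) :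
    (refl 𝓢 p k).IsTiltBounded :=
  ⟨1, fun n ↦ (tilt_refl 𝓢 p k n).le⟩

end LocalSubconvergence

/-- **Tilt-bounded pointed `Cᵏ_loc` subconvergence**: some datum of the convergence is
tilt-bounded (the framed / bounded-boost version of `SubconvergesLocallyTo`). [cite: Anderson2004, §5] -/
def SubconvergesLocallyTiltBoundedTo (𝓢ₙ : ℕ → Spacetime.{u} 4) (pₙ : ∀ n, (𝓢ₙ n).carrier)
    (𝓣 : Spacetime.{v} 4) (t : 𝓣.carrier) (k : ℕ) : Prop :=
  ∃ D : LocalSubconvergence 𝓢ₙ pₙ 𝓣 t k, D.IsTiltBounded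

/-- Tilt-bounded subconvergence implies subconvergence. [folklore] -/
theorem SubconvergesLocallyTiltBoundedTo.subconvergesLocallyTo {𝓢ₙ : ℕ → Spacetime.{u} 4}
    {pₙ : ∀ n, (𝓢ₙ n).carrier} {𝓣 : Spacetime.{v} 4} {t : 𝓣.carrier} {k : ℕ}
    (h : SubconvergesLocallyTiltBoundedTo 𝓢ₙ pₙ 𝓣 t k) : SubconvergesLocallyTo 𝓢ₙ pₙ 𝓣 t k := by
  obtain ⟨D, -⟩ := h
  exact ⟨D⟩

/-- **The constant sequence subconverges tilt-boundedly to itself.** [folklore] -/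
theorem SubconvergesLocallyTiltBoundedTo.refl (𝓢 : Spacetime.{u} 4) (p : 𝓢.carrier) (k : ℕ) :
    SubconvergesLocallyTiltBoundedTo (fun _ ↦ 𝓢) (fun _ ↦ p) 𝓢 p k :=
  ⟨LocalSubconvergence.refl 𝓢 p k, LocalSubconvergence.isTiltBounded_refl 𝓢 p k⟩

end Spacetime

end Literature.Geometry.Lorentzian
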